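import Literature.MathematicalPhysics.QuantumFieldTheory.Balaban1983to89.B8Ineq159CurvedCubeMemberUniform
import Literature.MathematicalPhysics.QuantumFieldTheory.Balaban1983to89.B8Ineq159FlatTopCubeMemberKernel
import Literature.MathematicalPhysics.QuantumFieldTheory.Balaban1983to89.B9SupplySockB9P3Zd

/-!
# `Balaban1983to89.B8Ineq159TopCubeTowerReads` — [Balaban1985RegularSpaces] (1.59) p. 86, (1.38) p. 82, (1.31) p. 82, (1.131) p. 99: the
# DICTIONARY between print's top-cube tower `(T, □₁, …, □_k)` of (1.131) (`Ω₀ = ℤᵈ`, `Λ′₀ = T ∖ □₁`, the class (1.31) `towerBondsP`) and the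
# cube member `{□_j}_{j=0}^{k}` of (1.132) (`Ω₀ = □₀`, `cubeLamS`, `cubeLamBP`) on which this seat's per-member curved (1.59) is stated —
# field locality of the (1.59) functionals, the transfer of the Landau condition (1.38), the level-`0` tower bonds, and
# the boundedness of the socket's weighted families

statement-level skeleton of published theorems with citation tags; proofs where landed; nothing here is a claim about the
Yang–Mills mass gap

`[Balaban1985RegularSpaces]` ("B8", CMP **99** (1985) 75–102) (1.1)–(1.2) p. 76, p. 77 (touching convention), (1.31) p. 82, (1.38) p. 82, (1.55)
p. 86, (1.59) p. 86, (1.131) p. 99 («Λ′₀ = T ∖ □₁»), p. 98 («a distance between boundaries of these cubes is equal to R₁M₁Lʲη»); [4] =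
`[Balaban1985BackgroundPropagators]` (3.23)–(3.25) p. 394; [B6] = `[Balaban1984PropagatorsII]` (2.3) p. 224; [B7] = `[Balaban1985Averaging]` p. 24
(locality of the averages).

CITATION HEADER (lean-in-tree rule).  Cell `pub-ymgap` (YM Track A, HUMAN RULING D-0062 ∕ D-0149), DAG node N05 = [B8], width seat `pub-ymgap-dag-n05-w3`
(g4), CLAIM-1 helper file.  WHY.  The per-member curved (1.59) of this lineage (`B8Ineq159CurvedCubeMemberUniform`, file (U)) is stated on the member
`{□_j}_{j=0}^{k}` of (1.132): Dirichlet domain `Ω₀ = □₀`, restriction sets `cubeLamS`, class `cubeLamBP`, field vanishing off the sides of the plaquettes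
touching the cubes.  The b9-socket of Proposition 3's frame (`B9SupplySockB9P3ZdGammaUnivDelta2.SockB9P3H2`) at print's top-cube tower of (1.131) reads
`Ω₀ = T`, `Λ′₀ = T ∖ □₁`, the class `towerBondsP`, a field bounded everywhere.  THIS FILE is the bookkeeping between the two readings; the companion
`B8SockB9P3H2AtTopCubeTower` draws the consequence.

THE MATHEMATICS (kernel-checked).  §1 FIELD LOCALITY: `covDivB_congr_fld`, `covLap_congr_fld`, ★ `Jcur_congr_fld` (the current (1.55) at `⟨x, x+e_μ⟩` reads
the field on the sides of the plaquettes through the bond — the field twin of (R)'s `Jcur_congr_bondNear`).  §2 ★★ `isLandau138_cube_of_univ` — THE LANDAU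
CONDITION (1.38) OF THE TOP-CUBE TOWER (Dirichlet domain `T`, `Λ′₀ = T ∖ □₁`) IMPLIES THE ONE OF THE CUBE MEMBER (Dirichlet domain `□₀`, `cubeLam₀ = □₀ ∖ □₁`)
for any two fields agreeing on the bonds touching `□₀`: the level-`0` multiplier is free on `□₀ ∖ □₁` for both, the cut-off `𝟙_{□₀}` is invisible inside `□₁`
(collar `ρ ≥ 1`), the levels `j ≥ 1` are identical.  §3 LEVEL `0` OF PRINT'S CLASS: a bond with both end-points off `□₁` is a level-`0` bond of `towerBondsP`
over `Λ′₀ = T ∖ □₁` (`mem_towerBondsP_zero_of_ends`); `cubeLamBP … k 0 ⊆ towerBondsP … 0`; the bonds of the levels `j ≥ 1` are finitely many.  §4 BOUNDEDNESS of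
the socket's weighted families for a globally bounded field (`bdd_Jcur_of_bound`, `exists_bound_linCovIter_towerBondsP` — levels `j ≥ 1` finitely many bonds,
level `0` the field itself).

HONEST SCOPE.  Bookkeeping only: no estimate of [B8] ∕ [4] is proved here; count-neutral; N05 NOT discharged; one finite `𝕋⁴` programme at fixed `ε`, Bałaban as
printed; the YM mass gap (Clay) is NOT proved by any of this — R4 closes the conditional finite-`𝕋⁴` rung `BalabanLadder.UV` only; nothing continuum ∕ ℝ⁴ ∕ OS.
No `sorry`, no `def`, no `instance`, no `notation`.  Unit `pub-ymgap-dag-n05-w3` (g4), 2026-08-28.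
-/

noncomputable section

namespace Literature.MathematicalPhysics.QuantumFieldTheory.Balaban1983to89.B8Ineq159TopCubeTowerReads

open B7Prop1Explicit B7Prop2Explicit B7Prop1Local B7Eq78Linearization
open B7Prop4GeneralLevels (linCovIter)
open B8Ineq132 (covDerivFwd covDeriv BondTouches PlaqTouches InAk)
open B8Eq140Level (SideTouches BondNear PlaqNear IsSide isSide₁ isSide₂ isSide₃ isSide₄ plaqNear₁ plaqNear₂ plaqNear₃ plaqNear₄ bondNear_of
  sideTouches_of_bondNear sideTouches_of_bondTouches sideTouches_mono)
open B8Eq146AExpansion (iEta plaqCovDeriv plaqCovDeriv_eq_covDerivFwd)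
open B8Eq143PlaqExpansion (pdiv)
open B8Eq155JBound (Jcur Jcur_def)
open B8ScaledSupNorm (bondNorm msup weight Bdd)
open B8Eq138LandauZd (IsLandau138 QT QprimeT covDivB covLap)
open B8Eq131CubesAdmissible (cubeFam cubeFam_true_zero cubeFam_false_zero cubeFam_false_of_le add_mem_cube_of_mem_succ)
open B8Eq131Cubes (cube sqLo sqHi inLo inHi cube_anti)
open B8CubeMemberZd (cubeLamS cubeLam cubeLamS_top mem_cubeLam_zero_iff inBox_sq_of_mem_cubeLamS)
open B8Ineq159FlatCubeMemberPrinted (cubeLamBP cubeLamBP_box_subset_pred)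
open B8Ineq159FlatCubeMemberKernel (inBox_in_zero_iff)
open B8Ineq159FlatCubeMemberPerCube (inBox_pred_of_bondTouches)
open B8Eq191FlatLettersCubeMember (inBox_finite)
open B8TowerBondsPrinted (towerBondsP)
open B9Ineq3137LocalSup (linCovIter_congr)

-- `Site` alone would resolve to the torus sites of `Setup.lean`; re-export the `ℤ^d` sites of `B7Prop1Explicit`.
export B7Prop1Explicit (Site)

variable {d : ℕ} {𝔸 : Type*} [NormedRing 𝔸] [NormOneClass 𝔸] [NormedAlgebra ℂ 𝔸] [CompleteSpace 𝔸]

/-! ## §1 Field locality of the (1.59) functionals -/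

section FieldLocality

variable {η : ℝ} {U₀ : Site d → Fin d → 𝔸ˣ}

omit [NormOneClass 𝔸] [CompleteSpace 𝔸] in
/-- **`D^{η*}_{U₀}A(x)` reads the field on the `2d` bonds `⟨x − e_ν, x⟩`, `⟨x, x + e_ν⟩`** ((1.1)₂ summed over `ν`). [cite: Balaban1985RegularSpaces, (1.1) p.76, (1.38) p.82] -/
theorem covDivB_congr_fld {A A' : Site d → Fin d → 𝔸} (x : Site d) (hm : ∀ ν, A (x - e ν) ν = A' (x - e ν) ν) (h0 : ∀ ν, A x ν = A' x ν) :
    covDivB η U₀ A x = covDivB η U₀ A' x := by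
  unfold covDivB
  refine Finset.sum_congr rfl fun ν _ => ?_
  simp only [covDeriv, hm ν, h0 ν]

omit [NormOneClass 𝔸] [CompleteSpace 𝔸] in
/-- **`Δ^η_{U₀}g(x)` reads `g` at `x`, `x ± e_ν`** ((3.23): `Σ_ν D^{η*}_{U₀,ν}D^η_{U₀,ν}`). [cite: Balaban1985BackgroundPropagators, (3.23) p.394] -/
theorem covLap_congr_fld {g g' : Site d → 𝔸} (x : Site d) (h0 : g x = g' x) (hp : ∀ ν, g (x + e ν) = g' (x + e ν))
    (hm : ∀ ν, g (x - e ν) = g' (x - e ν)) : covLap η U₀ g x = covLap η U₀ g' x := by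
  unfold covLap covDivB
  refine Finset.sum_congr rfl fun ν _ => ?_
  have e1 : x - e ν + e ν = x := sub_add_cancel x (e ν)
  simp only [covDeriv, covDerivFwd, e1, h0, hp ν, hm ν]

omit [NormOneClass 𝔸] [CompleteSpace 𝔸] in
/-- ★ **THE CURRENT (1.55) AT `⟨x, x + e_μ⟩` READS THE FIELD ON THE SIDES OF THE PLAQUETTES THROUGH THE BOND**: `J_{U₀}(A)_μ(x) =
Σ_{ν<μ}(D^{η*}_{U₀,ν}F_{νμ})(x) − Σ_{ν>μ}(D^{η*}_{U₀,ν}F_{μν})(x)`, `F = D^η_{U₀}A` reads `A` on the four sides of `p_{νμ}(x)` and of `p_{νμ}(x − e_ν)`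
(`B8Eq140Level.BondNear μ x`) — the field twin of `B8Ineq159CurvedCubeMemberReads.Jcur_congr_bondNear`.
[cite: Balaban1985RegularSpaces, (1.55) p.86, (1.1)–(1.2) p.76; Balaban1985BackgroundPropagators, (3.4) p.391] -/
theorem Jcur_congr_fld {A A' : Site d → Fin d → 𝔸} (μ : Fin d) (x : Site d)
    (h : ∀ (y : Site d) (τ : Fin d), BondNear μ x y τ → A y τ = A' y τ) : Jcur η U₀ A μ x = Jcur η U₀ A' μ x := by
  have key : ∀ (z : Site d) (κ ν : Fin d), PlaqNear μ x z κ ν → plaqCovDeriv η U₀ A κ ν z = plaqCovDeriv η U₀ A' κ ν z := by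
    intro z κ ν hq
    have h1 := h _ _ (bondNear_of hq (isSide₁ z κ ν))
    have h2 := h _ _ (bondNear_of hq (isSide₂ z κ ν))
    have h3 := h _ _ (bondNear_of hq (isSide₃ z κ ν))
    have h4 := h _ _ (bondNear_of hq (isSide₄ z κ ν))
    simp only [plaqCovDeriv_eq_covDerivFwd, covDerivFwd, h1, h2, h3, h4]
  rw [Jcur_def, Jcur_def]
  unfold pdiv
  congr 1
  · refine Finset.sum_congr rfl fun ν hν => ?_
    have hνμ : ν ≠ μ := (Finset.mem_Iio.mp hν).ne
    simp only [covDeriv, key x ν μ (plaqNear₁ hνμ), key (x - e ν) ν μ (plaqNear₃ hνμ)]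
  · refine Finset.sum_congr rfl fun ν hν => ?_
    have hνμ : ν ≠ μ := (Finset.mem_Ioi.mp hν).ne'
    simp only [covDeriv, key x μ ν (plaqNear₂ hνμ), key (x - e ν) μ ν (plaqNear₄ hνμ)]

omit [NormOneClass 𝔸] [CompleteSpace 𝔸] in
/-- **The current at a bond touching `S` reads the field on the sides of the plaquettes touching `S`** (a plaquette through a bond touching `S` touches
`S`). [cite: Balaban1985RegularSpaces, (1.55) p.86, p.77 (touching convention)] -/
theorem Jcur_congr_fld_touch {S : Set (Site d)} {A A' : Site d → Fin d → 𝔸} {μ : Fin d} {x : Site d} (hb : BondTouches S x μ)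
    (h : ∀ (y : Site d) (τ : Fin d), SideTouches S y τ → A y τ = A' y τ) : Jcur η U₀ A μ x = Jcur η U₀ A' μ x :=
  Jcur_congr_fld μ x fun y τ hn => h y τ (sideTouches_of_bondNear hb hn)

end FieldLocality

/-! ## §2 The Landau condition (1.38): from the top-cube tower `(T, □₁, …, □_k)` to the cube member `{□_j}_{j=0}^{k}` -/

section Landau

variable {η : ℝ} {U₀ : Site d → Fin d → 𝔸ˣ}

/-- A site within sup-distance `1` of `□₁` lies in `□₀` (`k ≥ 1`, collar width `ρ ≥ 1`, p. 98). [cite: Balaban1985RegularSpaces, p.98 («a distance between boundaries of these cubes is equal to R₁M₁Lʲη»)] -/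
theorem near_mem_cube_zero {L : ℕ} {a : Site d} {M ρ k : ℕ} (hρ : 1 ≤ ρ) (hk : 1 ≤ k) {x : Site d} (hx : x ∈ cube L a M ρ k 1)
    (t : Site d) (ht : ∀ i, |t i| ≤ 1) : x + t ∈ cube L a M ρ k 0 := by
  refine add_mem_cube_of_mem_succ (j := 0) (by omega) hx fun i => (ht i).trans ?_
  rw [pow_zero, mul_one]; exact_mod_cast hρ

/-- `x ± e_ν ∈ □₀` for `x ∈ □₁`. [cite: Balaban1985RegularSpaces, p.98] -/
theorem add_e_mem_cube_zero {L : ℕ} {a : Site d} {M ρ k : ℕ} (hρ : 1 ≤ ρ) (hk : 1 ≤ k) {x : Site d} (hx : x ∈ cube L a M ρ k 1)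
    (ν : Fin d) : x + e ν ∈ cube L a M ρ k 0 ∧ x - e ν ∈ cube L a M ρ k 0 := by
  refine ⟨near_mem_cube_zero hρ hk hx (e ν) fun i => ?_, ?_⟩
  · rw [e_apply]; split_ifs <;> simp
  · rw [sub_eq_add_neg]
    refine near_mem_cube_zero hρ hk hx (-e ν) fun i => ?_
    rw [Pi.neg_apply, e_apply]; split_ifs <;> simp

omit [NormOneClass 𝔸] in
/-- ★★ **THE LANDAU CONDITION (1.38) OF THE TOP-CUBE TOWER IMPLIES THE ONE OF THE CUBE MEMBER.**  Let `(T, □₁, …, □_k)` be print's tower of (1.131) with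
`Λ′₀ = T ∖ □₁` at level `0` and `Λ′_j` (`= cubeLamS … k j`) above, and `{□_j}_{j=0}^{k}` the member of (1.132) (`Ω₀ = □₀`, restriction sets `cubeLamS … k`,
`cubeLam₀ = □₀ ∖ □₁`).  If `A` satisfies (1.38) in multiplier form with Dirichlet domain `T` and `A′` agrees with `A` on the bonds touching `□₀`, then `A′`
satisfies (1.38) with Dirichlet domain `□₀`: on `□₀ ∖ □₁` the level-`0` multiplier is free for both conditions (`Q′₀ᵀ = id`); at `x ∈ □₁` the level-`0`
indicators vanish on both sides, the cut-off `𝟙_{□₀}` inside `Δ^η_{U₀}(𝟙 · D^{η*}A)` is invisible (the stencil reads `x, x ± e_ν ∈ □₀`, collar `ρ ≥ 1`), and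
the levels `j ≥ 1` carry the same multipliers on the same sets. [cite: Balaban1985RegularSpaces, (1.38) p.82, (1.131) p.99, (1.5) p.77, p.98; Balaban1985BackgroundPropagators, (3.23)–(3.25) p.394] -/
theorem isLandau138_cube_of_univ {L : ℕ} (hL : 1 ≤ L) (a : Site d) (M : ℕ) {ρ k : ℕ} (hρ : 1 ≤ ρ) (hk : 1 ≤ k)
    {Λ : ℕ → Set (Site d)} (hΛ0 : Λ 0 = (cube L a M ρ k 1)ᶜ) (hΛ : ∀ j, 1 ≤ j → j ≤ k → Λ j = cubeLamS L a M ρ k k j)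
    {A A' : Site d → Fin d → 𝔸} (hagree : ∀ (y : Site d) (τ : Fin d), BondTouches (cube L a M ρ k 0) y τ → A' y τ = A y τ)
    (hLan : IsLandau138 L k η (Set.univ : Set (Site d)) Λ U₀ A) :
    IsLandau138 L k η (cubeFam false L a M ρ k 0) (cubeLamS L a M ρ k k) U₀ A' := by
  classical
  obtain ⟨μ, hμ⟩ := hLan
  -- the common tail `Σ_{1 ≤ j ≤ k} Q′_jᵀ(𝟙_{Λ′_j} μ_j)`
  set tail : Site d → 𝔸 := fun x => ∑ j ∈ Finset.range k, QprimeT L U₀ (j + 1) ((cubeLamS L a M ρ k k (j + 1)).indicator (μ (j + 1))) x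
    with htail
  set g' : Site d → 𝔸 := (cube L a M ρ k 0).indicator (covDivB η U₀ A') with hg'
  refine ⟨fun j x => if j = 0 then covLap η U₀ g' x - tail x else μ j x, fun x hx => ?_⟩
  rw [cubeFam_false_zero] at hx
  -- the right-hand side at `x`: level `0` is the identity, the tail is the tail
  have hRHS : QT L k (cubeLamS L a M ρ k k) U₀ (fun j x => if j = 0 then covLap η U₀ g' x - tail x else μ j x) x =
      (cubeLamS L a M ρ k k 0).indicator (fun x => covLap η U₀ g' x - tail x) x + tail x := by
    unfold QT
    rw [Finset.sum_range_succ']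
    have h1 : ∀ j ∈ Finset.range k, QprimeT L U₀ (j + 1)
        ((cubeLamS L a M ρ k k (j + 1)).indicator ((fun (j : ℕ) (x : Site d) => if j = 0 then covLap η U₀ g' x - tail x else μ j x) (j + 1))) x =
        QprimeT L U₀ (j + 1) ((cubeLamS L a M ρ k k (j + 1)).indicator (μ (j + 1))) x := by
      intro j _
      have : (fun (x : Site d) => if j + 1 = 0 then covLap η U₀ g' x - tail x else μ (j + 1) x) = μ (j + 1) := by
        funext y; simp
      simp only [this]
    rw [Finset.sum_congr rfl h1, add_comm]
    rfl
  rw [cubeFam_false_zero, hRHS]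
  by_cases h1 : x ∈ cube L a M ρ k 1
  · -- inside `□₁`: the level-0 indicators vanish, the cut-off is invisible, the tails agree
    have hx0 : x ∉ cubeLamS L a M ρ k k 0 := by
      rw [cubeLamS_top L a M ρ (Nat.zero_le k), mem_cubeLam_zero_iff hL a M ρ hk]; exact fun h => h.2 h1
    rw [Set.indicator_of_notMem hx0, zero_add]
    -- print's condition at `x`
    have hP := hμ x (Set.mem_univ x)
    have hP' : covLap η U₀ (covDivB η U₀ A) x = tail x := by
      rw [Set.indicator_univ] at hP
      rw [hP]
      unfold QT
      rw [Finset.sum_range_succ']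
      have h0 : (Λ 0).indicator (μ 0) x = 0 := Set.indicator_of_notMem (by rw [hΛ0]; exact fun h => h h1) _
      have e0 : QprimeT L U₀ 0 ((Λ 0).indicator (μ 0)) x = (Λ 0).indicator (μ 0) x := rfl
      rw [e0, h0, add_zero]
      refine Finset.sum_congr rfl fun j hj => ?_
      rw [hΛ (j + 1) (by omega) (Nat.succ_le_of_lt (Finset.mem_range.mp hj))]
    rw [← hP']
    -- the cut-off is invisible at `x ∈ □₁`: the stencil reads `x`, `x ± e_ν`, all in `□₀`, where `A′` and `A` have the same divergence
    have hx00 : x ∈ cube L a M ρ k 0 := cube_anti (Nat.zero_le 1) hk h1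
    have hdiv : ∀ z, z ∈ cube L a M ρ k 0 → g' z = covDivB η U₀ A z := by
      intro z hz
      rw [hg', Set.indicator_of_mem hz]
      exact covDivB_congr_fld z (fun ν => hagree _ _ (Or.inr (by rw [sub_add_cancel]; exact hz))) fun ν => hagree _ _ (Or.inl hz)
    exact covLap_congr_fld x (hdiv x hx00) (fun ν => hdiv _ (add_e_mem_cube_zero hρ hk h1 ν).1)
      fun ν => hdiv _ (add_e_mem_cube_zero hρ hk h1 ν).2
  · -- on `□₀ ∖ □₁` the level-0 multiplier is free
    have hx0 : x ∈ cubeLamS L a M ρ k k 0 := by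
      rw [cubeLamS_top L a M ρ (Nat.zero_le k), mem_cubeLam_zero_iff hL a M ρ hk]; exact ⟨hx, h1⟩
    rw [Set.indicator_of_mem hx0, sub_add_cancel]

end Landau

/-! ## §3 Level `0` of print's class (1.31) over the top-cube tower: bonds with both ends off `□₁` -/

section LevelZero

/-- **A bond with both end-points off `□₁` is a level-`0` bond of print's class (1.31) over `(T, □₁, …, □_k)`** (`Λ′₀ = T ∖ □₁`; the level-`0` box
condition reads `Ω₀ = T`). [cite: Balaban1985RegularSpaces, (1.31) p.82, (1.131) p.99; Balaban1984PropagatorsII, (2.3) p.224] -/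
theorem mem_towerBondsP_zero_of_ends (L : ℕ) (a : Site d) (M ρ k : ℕ) {Λ : ℕ → Set (Site d)} (hΛ0 : Λ 0 = (cube L a M ρ k 1)ᶜ)
    {c : Site d × Fin d} (h1 : c.1 ∉ cube L a M ρ k 1) (h2 : c.1 + e c.2 ∉ cube L a M ρ k 1) :
    c ∈ towerBondsP L (cubeFam true L a M ρ k) Λ 0 := by
  refine Or.inl ⟨fun x _ => by rw [cubeFam_true_zero]; exact Set.mem_univ x, ?_, ?_⟩
  · rw [hΛ0]; exact h1
  · rw [hΛ0]; exact h2

/-- **A bond not touching `□₀` is a level-`0` bond of print's class over the top-cube tower** (`□₁ ⊂ □₀`). [cite: Balaban1985RegularSpaces, (1.31) p.82, (1.131) p.99] -/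
theorem mem_towerBondsP_zero_of_not_bondTouches (L : ℕ) (a : Site d) (M ρ : ℕ) {k : ℕ} (hk : 1 ≤ k) {Λ : ℕ → Set (Site d)}
    (hΛ0 : Λ 0 = (cube L a M ρ k 1)ᶜ) {y : Site d} {τ : Fin d} (h : ¬ BondTouches (cube L a M ρ k 0) y τ) :
    (y, τ) ∈ towerBondsP L (cubeFam true L a M ρ k) Λ 0 :=
  mem_towerBondsP_zero_of_ends L a M ρ k hΛ0 (fun h1 => h (Or.inl (cube_anti (Nat.zero_le 1) hk h1)))
    fun h2 => h (Or.inr (cube_anti (Nat.zero_le 1) hk h2))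

/-- **Level `0` of the member's class `cubeLamBP` lies in print's class over the top-cube tower** (both end-points off `□₁` by the class's level-`0`
clause). [cite: Balaban1985RegularSpaces, (1.31) p.82, (1.131) p.99; Balaban1984PropagatorsII, (2.3) p.224] -/
theorem cubeLamBP_zero_subset_towerBondsP {L : ℕ} (hL : 1 ≤ L) (a : Site d) (M ρ : ℕ) {k : ℕ} (hk : 1 ≤ k) {Λ : ℕ → Set (Site d)}
    (hΛ0 : Λ 0 = (cube L a M ρ k 1)ᶜ) : cubeLamBP L a M ρ k k 0 ⊆ towerBondsP L (cubeFam true L a M ρ k) Λ 0 := by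
  intro c hc
  obtain ⟨-, -, hdeep⟩ := hc
  obtain ⟨h1, h2⟩ := hdeep (by omega)
  rw [inBox_in_zero_iff hL a M ρ hk] at h1 h2
  exact mem_towerBondsP_zero_of_ends L a M ρ k hΛ0 h1 h2

/-- **Every bond of print's class over the top-cube tower at a level `j ≥ 1` has an end-point in the box `□_j^{(j)}`** (`Λ′_j ⊂ □_j^{(j)}`), hence these bonds
are FINITELY many. [cite: Balaban1985RegularSpaces, (1.31) p.82, (1.131) p.99] -/
theorem towerBondsP_pos_finite (L : ℕ) (a : Site d) (M ρ k : ℕ) {Λ : ℕ → Set (Site d)} (hΛ : ∀ j, 1 ≤ j → j ≤ k → Λ j = cubeLamS L a M ρ k k j) :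
    {p : ℕ × (Site d × Fin d) | 1 ≤ p.1 ∧ p.1 ≤ k ∧ p.2 ∈ towerBondsP L (cubeFam true L a M ρ k) Λ p.1}.Finite := by
  have hfin : ∀ j : ℕ, ({j} ×ˢ ({x : Site d | InBox (sqLo L a ρ k j - 1) (sqHi L a M ρ k j) x} ×ˢ (Set.univ : Set (Fin d)))).Finite :=
    fun j => (Set.finite_singleton j).prod ((inBox_finite _ _).prod Set.finite_univ)
  refine ((Finset.range (k + 1)).finite_toSet.biUnion fun j _ => hfin j).subset ?_
  rintro ⟨j, y, τ⟩ ⟨hj1, hjk, hc⟩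
  simp only [Set.mem_iUnion, Finset.coe_range, Set.mem_Iio, Set.mem_prod, Set.mem_singleton_iff, Set.mem_setOf_eq,
    Set.mem_univ, and_true, exists_prop]
  refine ⟨j, Nat.lt_succ_of_le hjk, rfl, ?_⟩
  -- an end-point of the bond lies in `Λ′_j ⊂ □_j^{(j)}`
  have hends : y ∈ Λ j ∨ y + e τ ∈ Λ j := by
    rcases hc with ⟨-, hy, -⟩ | ⟨-, ⟨-, -, -, hy⟩ | ⟨-, -, hy, -⟩⟩
    exacts [Or.inl hy, Or.inr hy, Or.inl hy]
  rw [hΛ j hj1 hjk] at hends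
  have hbt : BondTouches {x | InBox (sqLo L a ρ k j) (sqHi L a M ρ k j) x} y τ := by
    rcases hends with h | h
    exacts [Or.inl (inBox_sq_of_mem_cubeLamS h), Or.inr (inBox_sq_of_mem_cubeLamS h)]
  exact inBox_pred_of_bondTouches hbt

/-- **`towerBondsP L Ω Λ j` reads the restriction family only at the levels `j` and `j − 1`** (the inner disjunct reads `Λ_j`, the two crossing disjuncts
`Λ_j` and `Λ_{j−1}`). [cite: Balaban1985RegularSpaces, (1.31) p.82; Balaban1984PropagatorsII, (2.3) p.224] -/
theorem towerBondsP_congr_levels (L : ℕ) (Ω : ℕ → Set (Site d)) {Λ Λ' : ℕ → Set (Site d)} (j : ℕ) (h : Λ j = Λ' j)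
    (h' : Λ (j - 1) = Λ' (j - 1)) : towerBondsP L Ω Λ j = towerBondsP L Ω Λ' j := by
  have key : ∀ j', j = j' + 1 → Λ j' = Λ' j' := fun j' hj => by rw [hj, Nat.add_sub_cancel] at h'; exact h'
  ext c
  simp only [towerBondsP, Set.mem_setOf_eq, h]
  constructor
  · rintro (h1 | ⟨hb, ⟨j', hj, hx, hy⟩ | ⟨j', hj, hy, hx⟩⟩)
    · exact Or.inl h1
    · exact Or.inr ⟨hb, Or.inl ⟨j', hj, by rw [← key j' hj]; exact hx, hy⟩⟩
    · exact Or.inr ⟨hb, Or.inr ⟨j', hj, hy, by rw [← key j' hj]; exact hx⟩⟩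
  · rintro (h1 | ⟨hb, ⟨j', hj, hx, hy⟩ | ⟨j', hj, hy, hx⟩⟩)
    · exact Or.inl h1
    · exact Or.inr ⟨hb, Or.inl ⟨j', hj, by rw [key j' hj]; exact hx, hy⟩⟩
    · exact Or.inr ⟨hb, Or.inr ⟨j', hj, hy, by rw [key j' hj]; exact hx⟩⟩

/-- **The member's class at the levels `1 ≤ j ≤ k` lies in print's class over the top-cube tower, from the restriction family READ UP TO LEVEL `k` ONLY** —
`B8Ineq159FlatTopCubeMemberKernel.cubeLamBP_subset_towerBondsP_topCube` with its hypothesis on `Λ_j` asked for `1 ≤ j ≤ k` (the class at level `j` reads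
`Λ_j`, `Λ_{j−1}` only), the form an `IdxB8SubD` member supplies. [cite: Balaban1985RegularSpaces, (1.31) p.82, (1.131) p.99; Balaban1984PropagatorsII, (2.3) p.224] -/
theorem cubeLamBP_subset_towerBondsP_topCube_of_le {L : ℕ} (hL : 1 ≤ L) (a : Site d) (M : ℕ) {ρ : ℕ} (hρ : L ≤ ρ) {k : ℕ}
    {Λ : ℕ → Set (Site d)} (hΛ0 : Λ 0 = (cube L a M ρ k 1)ᶜ) (hΛ : ∀ j, 1 ≤ j → j ≤ k → Λ j = cubeLamS L a M ρ k k j)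
    {j : ℕ} (hj1 : 1 ≤ j) (hjk : j ≤ k) : cubeLamBP L a M ρ k k j ⊆ towerBondsP L (cubeFam true L a M ρ k) Λ j := by
  classical
  let Λ' : ℕ → Set (Site d) := fun l => if l ≤ k then Λ l else cubeLamS L a M ρ k k l
  have hΛ'0 : Λ' 0 = (cube L a M ρ k 1)ᶜ := by simp [Λ', hΛ0]
  have hΛ'j : ∀ l, 1 ≤ l → Λ' l = cubeLamS L a M ρ k k l := fun l hl => by
    by_cases hlk : l ≤ k
    · simp [Λ', hlk, hΛ l hl hlk]
    · simp [Λ', hlk]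
  have e1 : Λ' j = Λ j := by simp [Λ', hjk]
  have e2 : Λ' (j - 1) = Λ (j - 1) := by simp [Λ', show j - 1 ≤ k by omega]
  rw [← towerBondsP_congr_levels L (cubeFam true L a M ρ k) j e1 e2]
  exact B8Ineq159FlatTopCubeMemberKernel.cubeLamBP_subset_towerBondsP_topCube hL a M hρ le_rfl hΛ'0 hΛ'j hj1 hjk

end LevelZero

/-! ## §4 Boundedness of the socket's weighted families for a globally bounded field -/

section BoundedJ

variable {𝔹 : Type*} [CStarAlgebra 𝔹] [Nontrivial 𝔹] {η : ℝ} {U₀ : Site d → Fin d → 𝔹ˣ}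

/-- **The weighted family `(Lʲη)³‖J_{U₀}(A)_μ(x)‖`, `j ≤ k`, is bounded for a bounded field** (`‖J‖ ≤ 16d·η⁻²·sup‖A‖`, weights `≤ (Lᵏη)³`), so the p. 86
supremum `|J|₍₋₃₎` is attained by the real `iSup` (C⋆-algebra values, as the socket). [cite: Balaban1985RegularSpaces, (1.55) p.86, p.86 (definition after (1.55))] -/
theorem bdd_Jcur_of_bound {L : ℕ} (hL : 1 ≤ L) (hη : 0 < η) (hU : ∀ x κ, U₀ x κ ∈ U1 𝔹) (k : ℕ) (Ω : ℕ → Set (Site d))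
    {A : Site d → Fin d → 𝔹} {b : ℝ} (hb : 0 ≤ b) (hA : ∀ y τ, ‖A y τ‖ ≤ b) :
    Bdd L k η (-(3 : ℝ)) (fun j (c : Site d × Fin d) => BondTouches (Ω j) c.1 c.2) (fun c : Site d × Fin d => Jcur η U₀ A c.2 c.1) := by
  have hη0 : 0 ≤ η⁻¹ := inv_nonneg.2 hη.le
  have hG : ∀ (y : Site d) (κ τ : Fin d), ‖covDerivFwd η U₀ κ (fun z => A z τ) y‖ ≤ η⁻¹ * (b + b) := by
    intro y κ τ
    refine (B8Ineq159StencilsNearFlat.norm_covDerivFwd_le hU hη κ (fun z => A z τ) y).trans ?_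
    exact mul_le_mul_of_nonneg_left (add_le_add (hA (y + e κ) τ) (hA y τ)) hη0
  have hJ : ∀ (μ : Fin d) (x : Site d), ‖Jcur η U₀ A μ x‖ ≤ 8 * d * (η⁻¹ * (η⁻¹ * (b + b))) :=
    fun μ x => B9SupplySockB9P3Zd.norm_Jcur_le_of_grad hη hU hG μ x
  have hL1 : (1 : ℝ) ≤ L := by exact_mod_cast hL
  have hC0 : 0 ≤ 8 * (d : ℝ) * (η⁻¹ * (η⁻¹ * (b + b))) := by positivity
  refine B8ScaledSupNorm.bdd_of_forall (c := ((L : ℝ) ^ k * η) ^ 3 * (8 * d * (η⁻¹ * (η⁻¹ * (b + b))))) fun j hj c _ => ?_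
  have hw : ((L : ℝ) ^ j * η) ^ 3 ≤ ((L : ℝ) ^ k * η) ^ 3 :=
    pow_le_pow_left₀ (by positivity) (mul_le_mul_of_nonneg_right (pow_le_pow_right₀ hL1 hj) hη.le) 3
  have hw0 : 0 ≤ ((L : ℝ) ^ k * η) ^ 3 := by positivity
  have e3 : weight L η (-(3 : ℝ)) j = ((L : ℝ) ^ j * η) ^ 3 := by
    rw [show (-(3 : ℝ)) = -((3 : ℕ) : ℝ) by norm_num, B8ScaledSupNorm.weight_neg_natCast]
  rw [e3]
  exact mul_le_mul hw (hJ c.2 c.1) (norm_nonneg _) hw0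

end BoundedJ

section Bounded

variable {U₀ : Site d → Fin d → 𝔸ˣ}

omit [NormOneClass 𝔸] in
/-- **The family `‖LʲηQ_j(U₀)B(c)‖`, `j ≤ k`, `c` in print's class over the top-cube tower, is bounded for a bounded `B`**: the levels `j ≥ 1` are finitely many
bonds (`towerBondsP_pos_finite`), at level `0` the average is `B` itself (`Q₀ = id`). [cite: Balaban1985RegularSpaces, (1.31) p.82, (1.59) p.86 («|B₁|»); Balaban1985Averaging, (127) p.37] -/
theorem exists_bound_linCovIter_towerBondsP (L : ℕ) (a : Site d) (M ρ k : ℕ) {Λ : ℕ → Set (Site d)}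
    (hΛ : ∀ j, 1 ≤ j → j ≤ k → Λ j = cubeLamS L a M ρ k k j) {B : Site d → Fin d → 𝔸} {b : ℝ} (hB : ∀ y τ, ‖B y τ‖ ≤ b) :
    ∃ C : ℝ, ∀ p : {p : ℕ × (Site d × Fin d) // p.1 ≤ k ∧ p.2 ∈ towerBondsP L (cubeFam true L a M ρ k) Λ p.1},
      1 * ‖linCovIter L U₀ B p.1.1 p.1.2.1 p.1.2.2‖ ≤ C := by
  -- the finitely many values at the levels `j ≥ 1`
  set S := {p : ℕ × (Site d × Fin d) | 1 ≤ p.1 ∧ p.1 ≤ k ∧ p.2 ∈ towerBondsP L (cubeFam true L a M ρ k) Λ p.1} with hS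
  have hfin : (Set.image (fun p : ℕ × (Site d × Fin d) => ‖linCovIter L U₀ B p.1 p.2.1 p.2.2‖) S).Finite :=
    (towerBondsP_pos_finite L a M ρ k hΛ).image _
  obtain ⟨C₁, hC₁⟩ := hfin.bddAbove
  refine ⟨max b C₁, fun p => ?_⟩
  rw [one_mul]
  rcases Nat.eq_zero_or_pos p.1.1 with h0 | hpos
  · -- level `0`: the field itself
    have e0 : linCovIter L U₀ B p.1.1 p.1.2.1 p.1.2.2 = B p.1.2.1 p.1.2.2 := by rw [h0]; rfl
    rw [e0]
    exact (hB _ _).trans (le_max_left _ _)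
  · refine le_trans (hC₁ ⟨p.1, ⟨hpos, p.2.1, p.2.2⟩, rfl⟩) (le_max_right _ _)

end Bounded

end Literature.MathematicalPhysics.QuantumFieldTheory.Balaban1983to89.B8Ineq159TopCubeTowerReads

end
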